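import Mathlib.Analysis.SpecialFunctions.Trigonometric.Bounds
import Mathlib.Analysis.Complex.Basic
import Mathlib.Data.ZMod.Basic
import HarnessLib

/-!
# BalabanUVNodes ∕ N15 — THE KING-MODEL RUNG (PART Ϡ-a): THE LATTICE LANDAU LEVEL, FIBRE FORM — a discrete commutator (`a*a`) identity on the cycle, the discrete
# uncertainty principle it yields, and the HARPER-FIBRE BOUND `Σ|f(j+1)−f(j)|² + Σ|1−ζ_j|²|f(j)|² ≥ Λ(θ)·Σ|f(j)|²`, `Λ(θ) = |sin θ|∕2 − (1−cos θ)²∕4`, for every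
# phase sequence `ζ_{j+1} = e^{iθ}ζ_j` on `ℤ∕N` — LINEAR in the flux angle `θ` (half the lowest Landau level), where PART Ϳ's plaquette road gives `θ²∕8`
# (Track A, DAG node N15 = NE2; FAN-OUT v1.1 §N15 s3 «KING-MODEL RUNG … + what the curved case adds»; count-neutral)

HONEST FRAMING.  Count-neutral (cell `pub-ymgap`, seat `pub-ymgap-dag-n15-e` g47; `--supports stmt-QuantumFields-27247 --as helper` = K3ᴬ, KEY MAP v3).  Elementary real ∕
complex analysis on the finite cycle `ℤ∕N`; the engine of PART Ϡ (door (t3⁵²) of the seat's §g46, there marked open).  Its consumers (Ϡ-b ∕ Ϡ-c) transfer it to King's covariant fine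
operator `−cΔ_U + m²` ([King1986] (4.4) p.670 minimally coupled as in [Balaban1985BackgroundPropagators] (3.23) p.394, PART Ͱ-a `covLapF`) at the constant-flux field of PART Ͻ-q.
NOT Bałaban's `G_k(U)`; NOT [Balaban1985BackgroundPropagators] (3.42); NOT a node discharge (N15 of record untouched); nothing continuum ∕ ℝ⁴ ∕ OS ∕ Clay.

THE MATHEMATICS.  In the Landau gauge the constant-flux covariant Laplacian fibres over the transverse momentum into the Harper ∕ discrete magnetic operators
`(hf)(j) = 2f(j) − f(j+1) − f(j−1) + |1 − ζ_j|²f(j)` on `ℤ∕N`, `ζ_j = e^{i(θj+φ)}`, `|1−ζ_j|² = 2 − 2cos(θj+φ)` (PART Ϳ-n `covLapF_fluxLink_mulVec_kingSepVec`).  Near a well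
`θj + φ ≈ 0` this is the harmonic oscillator `p² + θ²x²`, whose zero-point energy `θ` is the lowest Landau level of the continuum problem `(p − A)² ≥ B`.  THE PROOF is the lattice
version of the oscillator factorisation `−∂² + g² − g′ = (−∂+g)(∂+g) ≥ 0`: for `f : ℤ∕N → ℂ` and real `g`,
  `Σ_j|f(j+1) − f(j) + g(j)f(j)|² = Σ_j(1 − g(j))|f(j+1) − f(j)|² + Σ_j(g(j)² + g(j−1) − g(j))|f(j)|²`   (§1, ★★ `sum_norm_sq_fwdDiff_add_mul`),
so `|g| ≤ 1` gives the DISCRETE UNCERTAINTY PRINCIPLE `Σ|∇f|² ≥ ½Σ_j(g(j) − g(j−1) − g(j)²)|f(j)|²` (★★ `sum_norm_sq_fwdDiff_ge`).  With `g(j) = ε·Im ζ_j = ε sin(θj+φ)`, `ε = ±1`,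
the pointwise inequality `½(g(j)−g(j−1)−g(j)²) + |1−ζ_j|² ≥ ½ε sin θ − ¼(1−cos θ)²` (§2, ★ `landau_pointwise`: with `k = cos ψ`, `s = sin ψ` it reads
`½(1−k)(3−k−ε sin θ) + ½ε(1−cos θ)s + ¼(1−cos θ)² ≥ ¼(s + ε(1−cos θ))² ≥ 0`) yields §3 ★★★ **`landau_fibre_bound`**: for EVERY `N ≥ 1`, every `f : ℤ∕N → ℂ`, every unit phase
sequence `ζ_{j+1} = ωζ_j` (`ω = e^{iθ}`, so `θ ∈ (2π∕N)ℤ` — the flux quantisation of a finite torus) and `ε = ±1`: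
  `(ε·Im ω∕2 − (1 − Re ω)²∕4)·Σ_j|f(j)|² ≤ Σ_j|f(j+1) − f(j)|² + Σ_j|1 − ζ_j|²·|f(j)|²`,
and with `ε = sgn(sin θ)` ★★★ **`landau_fibre_bound_gap`**: the left constant is `Λ(θ) := landauGap θ = |sin θ|∕2 − (1−cos θ)²∕4` (§4: `= θ∕2 − O(θ³)`; ★ `landauGap_ge_quarter`:
`Λ(θ) ≥ |θ|∕4` for `|θ| ≤ 1`; ★ `plaquetteGap_le_landauGap`: PART Ϳ's `2(2−2cos(θ∕4)) ≤ θ²∕8 ≤ Λ(θ)` for `0 < |θ| ≤ 1` — the Landau road dominates the plaquette road at small flux,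
by the factor `4∕|θ|`).  HONEST: numerically the true bottom of the Harper fibre at `θ = 2π∕N` is `θ(1 − θ∕8 + …)` (the Landau level itself); the factor `½` is the price of
`(1 − g) ≤ 2`; the bound is uniform in `N`, `φ` and needs no rationality bookkeeping beyond `ζ_{j+1} = ωζ_j` around the cycle.
PRIOR TREE ART (by name): Mathlib (`Complex.sq_norm`, `Complex.normSq_apply`, `Real.sin_le`, `Real.sin_gt_sub_cube`, `Real.one_sub_sq_div_two_le_cos`, `Real.cos_le_one`,
`Real.abs_sin_le_one`, `Complex.norm_exp_ofReal_mul_I`).  Dedup (rg at filing): basename 0 files; needles `landauGap|sum_norm_sq_fwdDiff|landau_fibre|landau_pointwise` 0 tree files.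
Locators (physics, notion only): the Landau level ∕ harmonic-oscillator factorisation is textbook ([LandauLifshitzQM] §112 «(p − eA∕c)²∕2m», notion); the lattice operator is Harper's
([Harper1955] Proc. Phys. Soc. A 68, notion; PART Ϳ-n header); King's operator [King1986] (4.4) p.670; the minimal coupling [Balaban1985BackgroundPropagators] (3.3) p.391, (3.23) p.394.
0 `sorry`, 1 `def` (`landauGap`).
-/

noncomputable section
open scoped BigOperators ComplexConjugate
open Finset

namespace Summit.QuantumFields.YangMills.BalabanUVNodes.N15KingModelRung.Landau

/-! ## §1 The discrete commutator identity and the discrete uncertainty principle on the cycle `ℤ∕N` -/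

section Commutator

variable {N : ℕ} [NeZero N]

/-- ONE BOND of the factorisation: for complex `a = f(j)`, `b = f(j+1)` and real `g`, `|b − a + g·a|² = (1−g)|b−a|² + (g²−g)|a|² + g|b|²`. [folklore] -/
theorem norm_sq_sub_add_mul (a b : ℂ) (g : ℝ) :
    ‖b - a + (g : ℂ) * a‖ ^ 2 = (1 - g) * ‖b - a‖ ^ 2 + (g ^ 2 - g) * ‖a‖ ^ 2 + g * ‖b‖ ^ 2 := by
  simp only [Complex.sq_norm, Complex.normSq_apply, Complex.sub_re, Complex.sub_im, Complex.add_re, Complex.add_im, Complex.mul_re, Complex.mul_im,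
    Complex.ofReal_re, Complex.ofReal_im]
  ring

/-- Re-indexing on the cycle: `Σ_j g(j)·|f(j+1)|² = Σ_j g(j−1)·|f(j)|²`. [folklore] -/
theorem sum_mul_norm_sq_succ (f : ZMod N → ℂ) (g : ZMod N → ℝ) : ∑ j, g j * ‖f (j + 1)‖ ^ 2 = ∑ j, g (j - 1) * ‖f j‖ ^ 2 :=
  Fintype.sum_equiv (Equiv.addRight 1) _ _ fun j => by simp

/-- ★★ **THE DISCRETE COMMUTATOR (`a*a`) IDENTITY ON THE CYCLE**: for `f : ℤ∕N → ℂ` and real `g`,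
`Σ_j|f(j+1) − f(j) + g(j)f(j)|² = Σ_j(1 − g(j))|f(j+1) − f(j)|² + Σ_j(g(j)² + g(j−1) − g(j))|f(j)|²` — the lattice form of `(−∂+g)(∂+g) = −∂² + g² − g′`. [folklore] -/
theorem sum_norm_sq_fwdDiff_add_mul (f : ZMod N → ℂ) (g : ZMod N → ℝ) :
    ∑ j, ‖f (j + 1) - f j + (g j : ℂ) * f j‖ ^ 2 = ∑ j, (1 - g j) * ‖f (j + 1) - f j‖ ^ 2 + ∑ j, (g j ^ 2 + g (j - 1) - g j) * ‖f j‖ ^ 2 := by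
  simp_rw [norm_sq_sub_add_mul]
  rw [Finset.sum_add_distrib, Finset.sum_add_distrib, sum_mul_norm_sq_succ, ← Finset.sum_add_distrib, ← Finset.sum_add_distrib, ← Finset.sum_add_distrib]
  exact Finset.sum_congr rfl fun j _ => by ring

/-- ★★ **THE DISCRETE UNCERTAINTY PRINCIPLE**: if `−1 ≤ g(j)` for all `j` then `½Σ_j(g(j) − g(j−1) − g(j)²)|f(j)|² ≤ Σ_j|f(j+1) − f(j)|²` (the left side of the identity is
`≥ 0` and `(1−g) ≤ 2`). [folklore] -/
theorem sum_norm_sq_fwdDiff_ge (f : ZMod N → ℂ) {g : ZMod N → ℝ} (hg : ∀ j, -1 ≤ g j) :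
    (1 / 2) * ∑ j, (g j - g (j - 1) - g j ^ 2) * ‖f j‖ ^ 2 ≤ ∑ j, ‖f (j + 1) - f j‖ ^ 2 := by
  have hid := sum_norm_sq_fwdDiff_add_mul f g
  have h0 : 0 ≤ ∑ j, ‖f (j + 1) - f j + (g j : ℂ) * f j‖ ^ 2 := Finset.sum_nonneg fun j _ => sq_nonneg _
  have h2 : ∑ j, (1 - g j) * ‖f (j + 1) - f j‖ ^ 2 ≤ 2 * ∑ j, ‖f (j + 1) - f j‖ ^ 2 := by
    rw [Finset.mul_sum]
    exact Finset.sum_le_sum fun j _ => mul_le_mul_of_nonneg_right (by linarith [hg j]) (sq_nonneg _)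
  have h3 : ∑ j, (g j - g (j - 1) - g j ^ 2) * ‖f j‖ ^ 2 = -∑ j, (g j ^ 2 + g (j - 1) - g j) * ‖f j‖ ^ 2 := by
    rw [← Finset.sum_neg_distrib]; exact Finset.sum_congr rfl fun j _ => by ring
  rw [h3]
  linarith

/-- The same with a general floor `−γ ≤ g`, `γ ≥ 0`: `Σ_j(g(j) − g(j−1) − g(j)²)|f(j)|² ≤ (1+γ)Σ_j|f(j+1) − f(j)|²`. [folklore] -/
theorem sum_norm_sq_fwdDiff_ge' (f : ZMod N → ℂ) {g : ZMod N → ℝ} {γ : ℝ} (hg : ∀ j, -γ ≤ g j) :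
    ∑ j, (g j - g (j - 1) - g j ^ 2) * ‖f j‖ ^ 2 ≤ (1 + γ) * ∑ j, ‖f (j + 1) - f j‖ ^ 2 := by
  have hid := sum_norm_sq_fwdDiff_add_mul f g
  have h0 : 0 ≤ ∑ j, ‖f (j + 1) - f j + (g j : ℂ) * f j‖ ^ 2 := Finset.sum_nonneg fun j _ => sq_nonneg _
  have h2 : ∑ j, (1 - g j) * ‖f (j + 1) - f j‖ ^ 2 ≤ (1 + γ) * ∑ j, ‖f (j + 1) - f j‖ ^ 2 := by
    rw [Finset.mul_sum]
    exact Finset.sum_le_sum fun j _ => mul_le_mul_of_nonneg_right (by linarith [hg j]) (sq_nonneg _)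
  have h3 : ∑ j, (g j - g (j - 1) - g j ^ 2) * ‖f j‖ ^ 2 = -∑ j, (g j ^ 2 + g (j - 1) - g j) * ‖f j‖ ^ 2 := by
    rw [← Finset.sum_neg_distrib]; exact Finset.sum_congr rfl fun j _ => by ring
  rw [h3]
  linarith

end Commutator

/-! ## §2 The pointwise Landau inequality -/

section Pointwise

/-- ★ **THE POINTWISE LANDAU INEQUALITY**: for a unit vector `(k,s) = (cos ψ, sin ψ)`, a unit vector `(cω,sω) = (cos θ, sin θ)` and `ε = ±1`,
`½(ε((1−cω)s + sω·k) − s²) + (2 − 2k) ≥ ½ε·sω − ¼(1−cω)²` — i.e. with `g = ε sin`, `½(g(ψ) − g(ψ−θ) − g(ψ)²) + (2−2cos ψ) ≥ ½ε sin θ − ¼(1−cos θ)²`.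
Proof: the left minus the right is `½(1−k)(3−k−ε sω) + ½ε(1−cω)s + ¼(1−cω)² ≥ ¼s² + ½ε(1−cω)s + ¼(1−cω)² = ¼(s + ε(1−cω))² ≥ 0`. [folklore] -/
theorem landau_pointwise {k s cω sω ε : ℝ} (hks : k ^ 2 + s ^ 2 = 1) (hω : cω ^ 2 + sω ^ 2 = 1) (hε : ε = 1 ∨ ε = -1) :
    ε * sω / 2 - (1 - cω) ^ 2 / 4 ≤ (1 / 2) * (ε * ((1 - cω) * s + sω * k) - s ^ 2) + (2 - 2 * k) := by
  have hε2 : ε ^ 2 = 1 := by rcases hε with h | h <;> rw [h] <;> norm_num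
  have hk1 : k ≤ 1 := by nlinarith [sq_nonneg s]
  have hεs : ε * sω ≤ 1 := by
    have h1 : (ε * sω) ^ 2 ≤ 1 := by rw [mul_pow, hε2, one_mul]; nlinarith [sq_nonneg cω]
    nlinarith [sq_nonneg (ε * sω - 1), sq_nonneg (ε * sω + 1)]
  -- `½(1−k)(3−k−ε sω) ≥ ½(1−k) ≥ ¼ s²`
  have hA : (1 / 4) * s ^ 2 ≤ (1 / 2) * ((1 - k) * (3 - k - ε * sω)) := by
    have h1 : 0 ≤ 1 - k := by linarith
    have h2 : (1 : ℝ) ≤ 3 - k - ε * sω := by linarith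
    have h3 : s ^ 2 ≤ 2 * (1 - k) := by nlinarith
    nlinarith [mul_le_mul_of_nonneg_left h2 h1]
  have hB : 0 ≤ (1 / 4) * (s + ε * (1 - cω)) ^ 2 := by positivity
  have hexp : (1 / 4) * (s + ε * (1 - cω)) ^ 2 = (1 / 4) * s ^ 2 + (1 / 2) * (ε * (1 - cω) * s) + (1 / 4) * (1 - cω) ^ 2 := by
    have : (s + ε * (1 - cω)) ^ 2 = s ^ 2 + 2 * (ε * (1 - cω) * s) + ε ^ 2 * (1 - cω) ^ 2 := by ring
    rw [this, hε2]; ring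
  nlinarith [hA, hB, hexp]

end Pointwise

/-! ## §3 The Harper-fibre bound on the cycle -/

section Fibre

variable {N : ℕ} [NeZero N]

/-- `|1 − ζ|² = 2 − 2·Re ζ` for a unit complex number `ζ`, together with `Re ζ² + Im ζ² = 1` (the tree's `re_sq_add_im_sq_of_norm_eq_one` of other summits, kept inline here). [folklore] -/
theorem norm_sq_one_sub_of_norm_eq_one {ζ : ℂ} (hζ : ‖ζ‖ = 1) : ‖1 - ζ‖ ^ 2 = 2 - 2 * ζ.re ∧ ζ.re ^ 2 + ζ.im ^ 2 = 1 := by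
  have h := Complex.sq_norm ζ
  rw [hζ, one_pow, Complex.normSq_apply] at h
  have h' : ζ.re ^ 2 + ζ.im ^ 2 = 1 := by nlinarith [h]
  refine ⟨?_, h'⟩
  rw [Complex.sq_norm, Complex.normSq_apply]
  simp only [Complex.sub_re, Complex.one_re, Complex.sub_im, Complex.one_im]
  nlinarith [h']

omit [NeZero N] in
/-- The ratio of a unit phase sequence is a unit: `ζ_{j+1} = ωζ_j`, `|ζ_j| = 1` ⟹ `|ω| = 1`. [folklore] -/
theorem norm_phaseRatio_eq_one {ζ : ZMod N → ℂ} {ω : ℂ} (hζ1 : ∀ j, ‖ζ j‖ = 1) (hζ : ∀ j, ζ (j + 1) = ω * ζ j) : ‖ω‖ = 1 := by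
  have h := congrArg norm (hζ 0)
  rw [norm_mul, hζ1, hζ1, mul_one] at h
  exact h.symm

omit [NeZero N] in
/-- `Im(ω̄·ζ) = Re ω·Im ζ − Im ω·Re ζ` — the phase one step back: `sin(ψ − θ) = cos θ sin ψ − sin θ cos ψ`. [folklore] -/
theorem im_pred_phase {ζ : ZMod N → ℂ} {ω : ℂ} (hζ1 : ∀ j, ‖ζ j‖ = 1) (hζ : ∀ j, ζ (j + 1) = ω * ζ j) (j : ZMod N) :
    (ζ (j - 1)).im = ω.re * (ζ j).im - ω.im * (ζ j).re := by
  have hω := norm_phaseRatio_eq_one hζ1 hζ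
  have h : ζ j = ω * ζ (j - 1) := by have := hζ (j - 1); rwa [sub_add_cancel] at this
  -- `ζ(j−1) = ω̄ ζ(j)` since `|ω| = 1`
  have hback : ζ (j - 1) = conj ω * ζ j := by
    rw [h, ← mul_assoc, ← Complex.normSq_eq_conj_mul_self, Complex.normSq_eq_norm_sq, hω]; simp
  rw [hback, Complex.mul_im, Complex.conj_re, Complex.conj_im]
  ring

/-- ★★★ **THE HARPER-FIBRE (LANDAU) BOUND ON THE CYCLE**: for every `N ≥ 1`, `f : ℤ∕N → ℂ`, every unit phase sequence `ζ_{j+1} = ωζ_j` and `ε = ±1`,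
`(ε·Im ω∕2 − (1−Re ω)²∕4)·Σ_j|f(j)|² ≤ Σ_j|f(j+1) − f(j)|² + Σ_j|1 − ζ_j|²|f(j)|²` — the bottom of the discrete magnetic fibre `2 − S − S^* + |1−ζ|²` lies above
`½ε sin θ − ¼(1−cos θ)²`, LINEARLY in the flux angle (half the Landau level `θ`), uniformly in `N` and in the phase offset. [folklore] -/
theorem landau_fibre_bound (f : ZMod N → ℂ) {ζ : ZMod N → ℂ} {ω : ℂ} (hζ1 : ∀ j, ‖ζ j‖ = 1) (hζ : ∀ j, ζ (j + 1) = ω * ζ j) {ε : ℝ} (hε : ε = 1 ∨ ε = -1) :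
    (ε * ω.im / 2 - (1 - ω.re) ^ 2 / 4) * ∑ j, ‖f j‖ ^ 2 ≤ ∑ j, ‖f (j + 1) - f j‖ ^ 2 + ∑ j, ‖1 - ζ j‖ ^ 2 * ‖f j‖ ^ 2 := by
  have hω := norm_phaseRatio_eq_one hζ1 hζ
  have hωsq := (norm_sq_one_sub_of_norm_eq_one hω).2
  -- the test function `g(j) = ε·Im ζ_j`
  set g : ZMod N → ℝ := fun j => ε * (ζ j).im with hg
  have hg1 : ∀ j, -1 ≤ g j := fun j => by
    have h1 := (norm_sq_one_sub_of_norm_eq_one (hζ1 j)).2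
    have him : |(ζ j).im| ≤ 1 := abs_le_one_iff_mul_self_le_one.mpr (by nlinarith [sq_nonneg (ζ j).re])
    have hεabs : |ε| = 1 := by rcases hε with h | h <;> rw [h] <;> norm_num
    have : |g j| ≤ 1 := by simp only [hg]; rw [abs_mul, hεabs, one_mul]; exact him
    exact (abs_le.mp this).1
  have hunc := sum_norm_sq_fwdDiff_ge f hg1
  -- pointwise: `Λ·|f j|² ≤ ½(g j − g(j−1) − g j²)|f j|² + |1−ζ_j|²|f j|²`
  have hpt : ∀ j, (ε * ω.im / 2 - (1 - ω.re) ^ 2 / 4) * ‖f j‖ ^ 2 ≤ (1 / 2) * ((g j - g (j - 1) - g j ^ 2) * ‖f j‖ ^ 2) + ‖1 - ζ j‖ ^ 2 * ‖f j‖ ^ 2 := by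
    intro j
    have hks := (norm_sq_one_sub_of_norm_eq_one (hζ1 j)).2
    have hp := landau_pointwise (k := (ζ j).re) (s := (ζ j).im) hks hωsq hε
    have hgj : g j - g (j - 1) - g j ^ 2 = ε * ((1 - ω.re) * (ζ j).im + ω.im * (ζ j).re) - (ζ j).im ^ 2 := by
      have hε2 : ε ^ 2 = 1 := by rcases hε with h | h <;> rw [h] <;> norm_num
      simp only [hg]
      rw [im_pred_phase hζ1 hζ j, mul_pow, hε2, one_mul]; ring
    rw [hgj, (norm_sq_one_sub_of_norm_eq_one (hζ1 j)).1]
    have h0 : 0 ≤ ‖f j‖ ^ 2 := sq_nonneg _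
    nlinarith [mul_le_mul_of_nonneg_right hp h0]
  calc (ε * ω.im / 2 - (1 - ω.re) ^ 2 / 4) * ∑ j, ‖f j‖ ^ 2 = ∑ j, (ε * ω.im / 2 - (1 - ω.re) ^ 2 / 4) * ‖f j‖ ^ 2 := by rw [Finset.mul_sum]
    _ ≤ ∑ j, ((1 / 2) * ((g j - g (j - 1) - g j ^ 2) * ‖f j‖ ^ 2) + ‖1 - ζ j‖ ^ 2 * ‖f j‖ ^ 2) := Finset.sum_le_sum fun j _ => hpt j
    _ = (1 / 2) * ∑ j, (g j - g (j - 1) - g j ^ 2) * ‖f j‖ ^ 2 + ∑ j, ‖1 - ζ j‖ ^ 2 * ‖f j‖ ^ 2 := by rw [Finset.sum_add_distrib, Finset.mul_sum]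
    _ ≤ _ := by linarith [hunc]

end Fibre

/-! ## §4 The Landau gap function `Λ(θ) = |sin θ|∕2 − (1 − cos θ)²∕4` -/

section Gap

/-- THE LANDAU GAP FUNCTION `Λ(θ) = |sin θ|∕2 − (1 − cos θ)²∕4` — the seat's lower bound for the bottom of the Harper fibre at flux angle `θ` (`= θ∕2 − O(|θ|³)`; the Landau
level itself is `|θ|`). [folklore] -/
def landauGap (θ : ℝ) : ℝ := |Real.sin θ| / 2 - (1 - Real.cos θ) ^ 2 / 4

/-- `Λ` in terms of a unit phase `ω = e^{iθ}` and the sign `ε = sgn(sin θ)`: `Λ(θ) = ε·Im ω∕2 − (1−Re ω)²∕4`. [folklore] -/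
theorem landauGap_eq_of_exp (θ : ℝ) : ∃ ε : ℝ, (ε = 1 ∨ ε = -1) ∧
    landauGap θ = ε * (Complex.exp (θ * Complex.I)).im / 2 - (1 - (Complex.exp (θ * Complex.I)).re) ^ 2 / 4 := by
  rw [Complex.exp_ofReal_mul_I_re, Complex.exp_ofReal_mul_I_im, landauGap]
  rcases le_or_gt 0 (Real.sin θ) with h | h
  · exact ⟨1, Or.inl rfl, by rw [abs_of_nonneg h, one_mul]⟩
  · exact ⟨-1, Or.inr rfl, by rw [abs_of_neg h]; ring⟩

variable {N : ℕ} [NeZero N]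

/-- ★★★ **THE FIBRE BOUND WITH THE LANDAU GAP**: if the phase sequence advances by `ω = e^{iθ}` then `Λ(θ)·Σ_j|f(j)|² ≤ Σ_j|f(j+1) − f(j)|² + Σ_j|1 − ζ_j|²|f(j)|²`.
[folklore] -/
theorem landau_fibre_bound_gap (f : ZMod N → ℂ) {ζ : ZMod N → ℂ} {θ : ℝ} (hζ1 : ∀ j, ‖ζ j‖ = 1) (hζ : ∀ j, ζ (j + 1) = Complex.exp (θ * Complex.I) * ζ j) :
    landauGap θ * ∑ j, ‖f j‖ ^ 2 ≤ ∑ j, ‖f (j + 1) - f j‖ ^ 2 + ∑ j, ‖1 - ζ j‖ ^ 2 * ‖f j‖ ^ 2 := by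
  obtain ⟨ε, hε, hΛ⟩ := landauGap_eq_of_exp θ
  rw [hΛ]
  exact landau_fibre_bound f hζ1 hζ hε

/-- `Λ` is even. [folklore] -/
theorem landauGap_neg (θ : ℝ) : landauGap (-θ) = landauGap θ := by
  simp [landauGap, Real.sin_neg, Real.cos_neg, abs_neg]

/-- `Λ(0) = 0` (no flux, no gap — King's massless `c(−Δ)` has the constants as zero modes, PART Ͱ-d). [folklore] -/
theorem landauGap_zero : landauGap 0 = 0 := by simp [landauGap]

/-- `Λ(θ) ≤ |sin θ|∕2 ≤ |θ|∕2`: the seat's constant is at most HALF the Landau level. [folklore] -/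
theorem landauGap_le_half (θ : ℝ) : landauGap θ ≤ |θ| / 2 := by
  have h1 : |Real.sin θ| ≤ |θ| := Real.abs_sin_le_abs
  have h2 : 0 ≤ (1 - Real.cos θ) ^ 2 / 4 := by positivity
  unfold landauGap; linarith

/-- ★ THE SMALL-FLUX FLOOR: `Λ(θ) ≥ |θ|∕2 − |θ|³∕12 − θ⁴∕16` for `|θ| ≤ 1` (`sin x > x − x³∕6` for `x > 0`, `1 − cos x ≤ x²∕2`). [folklore] -/
theorem landauGap_ge_poly {θ : ℝ} (hθ : |θ| ≤ 1) : |θ| / 2 - |θ| ^ 3 / 12 - θ ^ 4 / 16 ≤ landauGap θ := by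
  -- reduce to `t = |θ| ∈ [0,1]` by evenness
  wlog h0 : 0 ≤ θ generalizing θ
  · have h := this (θ := -θ) (by rwa [abs_neg]) (by linarith [le_of_not_ge h0])
    rwa [abs_neg, landauGap_neg, show (-θ) ^ 4 = θ ^ 4 by ring] at h
  rw [abs_of_nonneg h0] at hθ ⊢
  unfold landauGap
  have hcos : 1 - Real.cos θ ≤ θ ^ 2 / 2 := by linarith [Real.one_sub_sq_div_two_le_cos (x := θ)]
  have hcos0 : 0 ≤ 1 - Real.cos θ := by linarith [Real.cos_le_one θ]
  have hsq : (1 - Real.cos θ) ^ 2 ≤ (θ ^ 2 / 2) ^ 2 := pow_le_pow_left₀ hcos0 hcos 2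
  rcases eq_or_lt_of_le h0 with h | h
  · subst h; simp
  · have hsin : θ - θ ^ 3 / 6 < Real.sin θ := Real.sin_gt_sub_cube h
    have hsin0 : 0 ≤ Real.sin θ := Real.sin_nonneg_of_nonneg_of_le_pi h0 (by linarith [Real.two_le_pi])
    rw [abs_of_nonneg hsin0]
    nlinarith [hsq, hsin]

/-- ★ **`Λ(θ) ≥ |θ|∕4` for `|θ| ≤ 1`** — a clean linear floor. [folklore] -/
theorem landauGap_ge_quarter {θ : ℝ} (hθ : |θ| ≤ 1) : |θ| / 4 ≤ landauGap θ := by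
  have h := landauGap_ge_poly hθ
  have h0 : 0 ≤ |θ| := abs_nonneg θ
  have h2 : |θ| ^ 2 ≤ 1 := pow_le_one₀ (n := 2) h0 hθ
  have h3 : |θ| ^ 3 ≤ |θ| := by nlinarith [h2, h0]
  have h4 : θ ^ 4 ≤ |θ| := by
    have : θ ^ 4 = |θ| ^ 4 := by rw [← abs_pow, abs_of_nonneg (by positivity : (0:ℝ) ≤ θ ^ 4)]
    rw [this]
    have h3' : |θ| ^ 3 ≤ 1 := pow_le_one₀ (n := 3) h0 hθ
    nlinarith [h3', h0]
  linarith

/-- `Λ(θ) > 0` for `0 < |θ| ≤ 1`. [folklore] -/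
theorem landauGap_pos {θ : ℝ} (hθ : |θ| ≤ 1) (hθ0 : θ ≠ 0) : 0 < landauGap θ :=
  lt_of_lt_of_le (by positivity) (landauGap_ge_quarter hθ)

/-- ★ **THE LANDAU ROAD DOMINATES THE PLAQUETTE ROAD AT SMALL FLUX**: PART Ϳ's curvature mass `2(2 − 2cos(θ∕4)) ≤ θ²∕8 ≤ |θ|∕8 ≤ Λ(θ)` for `|θ| ≤ 1` (indeed `Λ∕(θ²∕8) ≥ 2∕|θ|`).
[folklore] -/
theorem plaquetteGap_le_landauGap {θ : ℝ} (hθ : |θ| ≤ 1) : 2 * (2 - 2 * Real.cos (θ / 4)) ≤ landauGap θ := by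
  have h1 : 2 - 2 * Real.cos (θ / 4) ≤ (θ / 4) ^ 2 := by linarith [Real.one_sub_sq_div_two_le_cos (x := θ / 4)]
  have h1' : (θ / 4) ^ 2 = θ ^ 2 / 16 := by ring
  have h2 : θ ^ 2 ≤ |θ| := by rw [← sq_abs]; nlinarith [abs_nonneg θ]
  linarith [landauGap_ge_quarter hθ, abs_nonneg θ]

end Gap

end Summit.QuantumFields.YangMills.BalabanUVNodes.N15KingModelRung.Landau

end
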